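import Literature.AlgebraicGeometry.Deformation.HypersurfaceT1Jacobian
import Mathlib.LinearAlgebra.TensorProduct.Quotient
import HarnessLib

/-!
# `T⁰` of a hypersurface and the node `k[x,y]/(xy)` (Hartshorne, *Deformation Theory*, §3 Ex. 3.1, Prop. 3.10)

Layer `Literature/AlgebraicGeometry/Deformation` (family `hodge`; LT-H1 «semiregularity consumers», cell `pub-hsemireg`,
width seat hsemireg-lit-8 g8). Successor of `HypersurfaceT1Jacobian` (same seat: `T¹(B/k, M) ≅ M ⧸ J·M` for
`B = k[x_1, …, x_n]/(f)`, `J` the Jacobian ideal, [Hartshorne2010, §3 Ex. 3.2]). Two complements, both PROVED: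

* **`T⁰` of a hypersurface.** [Hartshorne2010, Prop. 3.10, p. 23]: for `A = k[x]`, `B = A/I`, «`0 → T⁰(B/k, M) →
  Hom(Ω_{A/k}, M) → Hom(I/I², M) → T¹(B/k, M) → 0`». For `I = (f)` with `f` a non-zero-divisor the middle arrow is, in the
  coordinates `Hom_B(Ω_{A/k} ⊗ B, M) = M^n` (`φ ↦ (φ(dx_i))_i`) and `Hom_B(I/I², M) = M` (`ψ ↦ ψ(f̄)`) of the predecessor
  file, the Jacobian row `(m_i)_i ↦ Σ_i (∂f/∂x_i)‾ m_i`; hence **`T⁰(B/k, M) = Der_k(B, M) ≅ {m ∈ M^n : Σ_i (∂f/∂x_i)‾ m_i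
  = 0}`** (`jacobianMap`, `mem_T0_iff_sum_eq_zero`, `T0.equivKerJacobian`, `derivationEquivKerJacobian`).
* **The node, Ex. 3.1 as printed.** [Hartshorne2010, §3 Ex. 3.1, p. 25 (held text `book:springernd-deformation-theory`,
  chunk p0030:L9)], verbatim: «Let `B = k[x,y]/(xy)`. Show that `T¹(B/k, M) = M ⊗ k` … for any `B`-module `M`.» Here
  `B₀ = nodeRing k := k[x_0, x_1]/(x_0 x_1)` with its tautological presentation `nodeGenerators k` (Mathlib's
  `Generators.naive`), `x_0 x_1` is a non-zero-divisor of `k[x_0, x_1]` over ANY commutative ring `k`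
  (`node_equation_regular`), its Jacobian ideal is `(x̄_1, x̄_0) = (x̄_0, x̄_1) = 𝔪`, the ideal of the node
  (`node_jacobianIdeal`), and therefore **`T¹(B₀/k, M) ≅ M ⧸ 𝔪M ≅ M ⊗_{B₀} (B₀/𝔪)`** (`node_T1_equivQuot`,
  `node_T1Self_equivQuot`, `node_T1_equivTensor`) — the book's «`M ⊗ k`», `k = B₀/𝔪` being the residue field of the node
  when `k` is a field; in particular `T¹(B₀/k, B₀) ≅ B₀/𝔪 ≠ 0` for `k ≠ 0` (`nodeIdeal_ne_top`, `node_T1Self_nontrivial`):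
  the node is not rigid.

HONEST SCOPE. Ex. 3.1's clause `T²(B/k, M) = 0` is not typed (needs [Thm. 3.5] in degree 2, not in the tree; cf. the
predecessor's docstring); the identification `B₀/𝔪 ≅ k` is not spelled out (the statement is given with `B₀ ⧸ 𝔪`). No named
fact (net debt 0), no `sorry`, no instance, no notation. Grade: REFEREED textbook (exercise ∕ proposition, computation supplied
here). Nothing here asserts HC ∕ HC_CM ∕ HC_AV or any semiregularity statement.

## References

* [Hartshorne2010] R. Hartshorne, *Deformation Theory*, GTM 257, Springer (2010): §3 Ex. 3.1, p. 25; Prop. 3.10, p. 23;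
  Construction 3.1, pp. 18–19.
-/

noncomputable section

open TensorProduct KaehlerDifferential MvPolynomial

namespace Literature.AlgebraicGeometry.Deformation.LichtenbaumSchlessinger.Hypersurface

open Algebra Algebra.Extension Algebra.Generators

universe u v w uM

variable {k : Type u} {B : Type v} [CommRing k] [CommRing B] [Algebra k B] {ι : Type w}
variable (P : Algebra.Generators k B ι) (f : P.Ring)
variable (M : Type uM) [AddCommGroup M] [Module B M]

/-! ## §1 `T⁰(B/k, M) = {m ∈ M^n : Σ_i (∂f/∂x_i)‾ m_i = 0}` -/

/-- **The Jacobian row** `M^n → M`, `(m_i)_i ↦ Σ_i (∂f/∂x_i)‾ · m_i` (the map `Hom(Ω_{A/k} ⊗ B, M) → Hom(I/I², M)` of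
[Prop. 3.10] in coordinates). [cite: Hartshorne2010, Prop. 3.10, p. 23; §3 Ex. 3.2, p. 25] -/
def jacobianMap [Fintype ι] : (ι → M) →ₗ[B] M :=
  ∑ i, aeval P.val (pderiv i f) • LinearMap.proj i

/-- [cite: Hartshorne2010, Prop. 3.10, p. 23] -/
@[simp]
theorem jacobianMap_apply [Fintype ι] (m : ι → M) :
    jacobianMap P f M m = ∑ i, aeval P.val (pderiv i f) • m i := by
  simp [jacobianMap, LinearMap.sum_apply]

/-- The image of the Jacobian row is `J · M`. [cite: Hartshorne2010, Prop. 3.10, p. 23; §3 Ex. 3.2, p. 25] -/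
theorem range_jacobianMap [Fintype ι] :
    LinearMap.range (jacobianMap P f M) = jacobianIdeal P f • (⊤ : Submodule B M) := by
  apply le_antisymm
  · rintro _ ⟨m, rfl⟩
    rw [jacobianMap_apply]
    exact sum_smul_mem_jacobian_smul_top P f M m
  · rw [jacobianIdeal, Ideal.span, Submodule.span_smul_eq]
    refine Submodule.set_smul_le _ _ _ ?_
    rintro _ x ⟨i, rfl⟩ -
    classical
    refine ⟨Pi.single i x, ?_⟩
    rw [jacobianMap_apply, Finset.sum_eq_single i (fun j _ hj => by rw [Pi.single_eq_of_ne hj, smul_zero])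
      (fun h => absurd (Finset.mem_univ i) h), Pi.single_eq_same]

/-- **`Hom_B(Ω_{k[x]/k} ⊗ B, M) ≃ M^n`, `φ ↦ (φ(dx_i))_i`** (`Ω_{k[x]/k} ⊗ B` is free on the `dx_i`).
[cite: Hartshorne2010, Prop. 3.10, p. 23] -/
def homCotangentSpaceEquivPi : (P.toExtension.CotangentSpace →ₗ[B] M) ≃ₗ[B] (ι → M) :=
  (P.cotangentSpaceBasis.constr B).symm

/-- [cite: Hartshorne2010, Prop. 3.10, p. 23] -/
@[simp]
theorem homCotangentSpaceEquivPi_apply (φ : P.toExtension.CotangentSpace →ₗ[B] M) (i : ι) :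
    homCotangentSpaceEquivPi P M φ i = φ (P.cotangentSpaceBasis i) :=
  rfl

/-- In coordinates, `d₁^*` (read through `Hom(I/I², M) = M`) IS the Jacobian row:
`(d₁^* φ)(f̄) = jacobianMap (φ(dx_i))_i`. [cite: Hartshorne2010, Prop. 3.10, p. 23] -/
theorem evalGenClass_precompD1_eq_jacobianMap [Fintype ι] (hker : P.ker = Ideal.span {f})
    (hf : ∀ r : P.Ring, r * f = 0 → r = 0) (φ : P.toExtension.CotangentSpace →ₗ[B] M) :
    evalGenClass P f M hker hf (precompD1 P.toExtension M φ) = jacobianMap P f M (homCotangentSpaceEquivPi P M φ) := by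
  rw [evalGenClass_precompD1, jacobianMap_apply]; rfl

/-- **`T⁰(B/k, M) = {φ : Σ_i (∂f/∂x_i)‾ φ(dx_i) = 0}`**: a `B`-linear `φ : Ω_{k[x]/k} ⊗ B → M` kills `d₁` iff its values on
the `dx_i` are orthogonal to the gradient of `f`. [cite: Hartshorne2010, Prop. 3.10, p. 23] -/
theorem mem_T0_iff_sum_eq_zero [Fintype ι] (hker : P.ker = Ideal.span {f}) (hf : ∀ r : P.Ring, r * f = 0 → r = 0)
    (φ : P.toExtension.CotangentSpace →ₗ[B] M) :
    φ ∈ T0 P.toExtension M ↔ ∑ i, aeval P.val (pderiv i f) • φ (P.cotangentSpaceBasis i) = 0 := by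
  rw [T0, LinearMap.mem_ker, ← evalGenClass_precompD1 P f M hker hf, map_eq_zero_iff _ (evalGenClass P f M hker hf).injective]

/-- Under `φ ↦ (φ(dx_i))_i`, `T⁰(B/k, M)` is carried onto the kernel of the Jacobian row.
[cite: Hartshorne2010, Prop. 3.10, p. 23] -/
theorem map_homCotangentSpaceEquivPi_T0 [Fintype ι] (hker : P.ker = Ideal.span {f})
    (hf : ∀ r : P.Ring, r * f = 0 → r = 0) :
    (T0 P.toExtension M).map (homCotangentSpaceEquivPi P M : _ →ₗ[B] (ι → M)) =
      LinearMap.ker (jacobianMap P f M) := by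
  ext m
  rw [Submodule.map_equiv_eq_comap_symm, Submodule.mem_comap, LinearMap.mem_ker, LinearEquiv.coe_coe,
    mem_T0_iff_sum_eq_zero P f M hker hf, jacobianMap_apply]
  simp_rw [homCotangentSpaceEquivPi, LinearEquiv.symm_symm, Module.Basis.constr_basis]

/-- **`T⁰(B/k, M) ≅ ker((m_i)_i ↦ Σ_i (∂f/∂x_i)‾ m_i) ⊆ M^n`** for the hypersurface `B = k[x_1, …, x_n]/(f)`, `f` a
non-zero-divisor. [cite: Hartshorne2010, Prop. 3.10, p. 23] -/
def T0.equivKerJacobian [Fintype ι] (hker : P.ker = Ideal.span {f}) (hf : ∀ r : P.Ring, r * f = 0 → r = 0) :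
    T0 P.toExtension M ≃ₗ[B] LinearMap.ker (jacobianMap P f M) :=
  LinearEquiv.ofSubmodules (homCotangentSpaceEquivPi P M) _ _ (map_homCotangentSpaceEquivPi_T0 P f M hker hf)

/-- Coordinates of the equivalence: the `i`-th component of the image of `φ` is `φ(dx_i)`.
[cite: Hartshorne2010, Prop. 3.10, p. 23] -/
@[simp]
theorem T0.equivKerJacobian_apply [Fintype ι] (hker : P.ker = Ideal.span {f}) (hf : ∀ r : P.Ring, r * f = 0 → r = 0)
    (φ : T0 P.toExtension M) (i : ι) :
    (T0.equivKerJacobian P f M hker hf φ : ι → M) i = (φ : P.toExtension.CotangentSpace →ₗ[B] M) (P.cotangentSpaceBasis i) :=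
  rfl

/-- **`Der_k(B, M) ≅ {m ∈ M^n : Σ_i (∂f/∂x_i)‾ m_i = 0}`** — `T⁰(B/k, M) = Der_k(B, M)` ([Hartshorne2010, Prop. 3.6 (b)]; the
tree's `T0.equivDerivation`) combined with the above: a `k`-derivation of the hypersurface algebra is a gradient-orthogonal
tuple of values on the coordinates. [cite: Hartshorne2010, Prop. 3.10, p. 23; Prop. 3.6, p. 21] -/
def derivationEquivKerJacobian [Fintype ι] [Module k M] [IsScalarTower k B M] (hker : P.ker = Ideal.span {f})
    (hf : ∀ r : P.Ring, r * f = 0 → r = 0) : Derivation k B M ≃ₗ[B] LinearMap.ker (jacobianMap P f M) :=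
  (T0.equivDerivation P.toExtension M).symm.trans (T0.equivKerJacobian P f M hker hf)

/-! ## §2 The node `B₀ = k[x_0, x_1]/(x_0 x_1)`: `T¹(B₀/k, M) ≅ M/𝔪M = M ⊗ (B₀/𝔪)` (Ex. 3.1) -/

section Node

variable (k : Type u) [CommRing k]

/-- The equation `x_0 x_1 ∈ k[x_0, x_1]` of the node. [cite: Hartshorne2010, §3 Ex. 3.1, p. 25] -/
def nodeEquation : MvPolynomial (Fin 2) k := X 0 * X 1

/-- **The node** `B₀ = k[x_0, x_1]/(x_0 x_1)` («`B = k[x,y]/(xy)`»). [cite: Hartshorne2010, §3 Ex. 3.1, p. 25] -/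
abbrev nodeRing : Type u := MvPolynomial (Fin 2) k ⧸ Ideal.span {nodeEquation k}

/-- Its tautological presentation `k[x_0, x_1] ↠ B₀` (`x_i ↦ x̄_i`). [cite: Hartshorne2010, §3 Ex. 3.1, p. 25] -/
def nodeGenerators : Algebra.Generators k (nodeRing k) (Fin 2) :=
  Generators.naive

/-- [cite: Hartshorne2010, §3 Ex. 3.1, p. 25] -/
@[simp]
theorem nodeGenerators_val (i : Fin 2) : (nodeGenerators k).val i = Ideal.Quotient.mk _ (X i) := by
  simp [nodeGenerators]

/-- The kernel of the presentation is `(x_0 x_1)`. [cite: Hartshorne2010, §3 Ex. 3.1, p. 25] -/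
theorem nodeGenerators_ker : (nodeGenerators k).ker = Ideal.span {nodeEquation k} :=
  Generators.ker_naive _ _

/-- `x_0 x_1` is a non-zero-divisor of `k[x_0, x_1]` (over any commutative ring `k`).
[cite: Hartshorne2010, §3 Ex. 3.1, p. 25] -/
theorem node_equation_regular (r : (nodeGenerators k).Ring) (h : r * nodeEquation k = 0) : r = 0 := by
  have hreg : IsRegular (nodeEquation k) := (isRegular_X (n := (0 : Fin 2))).mul (isRegular_X (n := 1))
  exact hreg.right (show r * nodeEquation k = 0 * nodeEquation k by rw [h, zero_mul])

/-- The ideal `𝔪 = (x̄_0, x̄_1) ⊆ B₀` of the node. [cite: Hartshorne2010, §3 Ex. 3.1, p. 25] -/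
def nodeIdeal : Ideal (nodeRing k) :=
  Ideal.span {Ideal.Quotient.mk _ (X 0), Ideal.Quotient.mk _ (X 1)}

/-- `∂(x_0 x_1)/∂x_0 = x_1`, `∂(x_0 x_1)/∂x_1 = x_0`: the images of the partials are `x̄_1, x̄_0`.
[cite: Hartshorne2010, §3 Ex. 3.1, p. 25] -/
theorem node_aeval_pderiv (i : Fin 2) :
    aeval (nodeGenerators k).val (pderiv i (nodeEquation k)) = Ideal.Quotient.mk _ (X (1 - i)) := by
  fin_cases i
  · simp [nodeEquation, Derivation.leibniz, pderiv_X]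
  · simp [nodeEquation, Derivation.leibniz, pderiv_X]

/-- **The Jacobian ideal of the node is `𝔪 = (x̄_0, x̄_1)`** (`(f_x, f_y) = (ȳ, x̄)`).
[cite: Hartshorne2010, §3 Ex. 3.1, p. 25] -/
theorem node_jacobianIdeal : jacobianIdeal (nodeGenerators k) (nodeEquation k) = nodeIdeal k := by
  rw [jacobianIdeal, nodeIdeal]
  congr 1
  ext b
  simp only [Set.mem_range, node_aeval_pderiv, Set.mem_insert_iff, Set.mem_singleton_iff]
  constructor
  · rintro ⟨i, rfl⟩
    fin_cases i
    · exact Or.inr rfl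
    · exact Or.inl rfl
  · rintro (rfl | rfl)
    · exact ⟨1, rfl⟩
    · exact ⟨0, rfl⟩

variable (M₀ : Type uM) [AddCommGroup M₀] [Module (nodeRing k) M₀]

/-- **Ex. 3.1: `T¹(B₀/k, M) ≅ M ⧸ 𝔪M`** on the presentation `k[x_0, x_1] ↠ B₀`.
[cite: Hartshorne2010, §3 Ex. 3.1, p. 25] -/
def node_T1_equivQuot :
    T1 (nodeGenerators k).toExtension M₀ ≃ₗ[nodeRing k] M₀ ⧸ nodeIdeal k • (⊤ : Submodule (nodeRing k) M₀) :=
  T1.equivQuotOfJacobianEq (nodeGenerators k) (nodeEquation k) M₀ (nodeGenerators_ker k) (node_equation_regular k)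
    (nodeIdeal k) (node_jacobianIdeal k)

/-- **Ex. 3.1 for the canonical `T¹`: `T¹(B₀/k, M) ≅ M ⧸ 𝔪M`.** [cite: Hartshorne2010, §3 Ex. 3.1, p. 25; Lemma 3.3, p. 20] -/
def node_T1Self_equivQuot :
    T1Self k (nodeRing k) M₀ ≃ₗ[nodeRing k] M₀ ⧸ nodeIdeal k • (⊤ : Submodule (nodeRing k) M₀) :=
  (T1.generatorsEquiv M₀ (Generators.self k (nodeRing k)) (nodeGenerators k)).trans (node_T1_equivQuot k M₀)

/-- **Ex. 3.1 as printed: `T¹(B₀/k, M) = M ⊗ (B₀/𝔪)`** («`= M ⊗ k`», `B₀/𝔪` the residue ring of the node).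
[cite: Hartshorne2010, §3 Ex. 3.1, p. 25] -/
def node_T1_equivTensor :
    T1Self k (nodeRing k) M₀ ≃ₗ[nodeRing k] M₀ ⊗[nodeRing k] (nodeRing k ⧸ nodeIdeal k) :=
  (node_T1Self_equivQuot k M₀).trans (TensorProduct.tensorQuotEquivQuotSMul M₀ (nodeIdeal k)).symm

/-- In particular `T¹(B₀/k, M) = 0 ↔ 𝔪M = M`. [cite: Hartshorne2010, §3 Ex. 3.1, p. 25] -/
theorem node_T1_subsingleton_iff :
    Subsingleton (T1Self k (nodeRing k) M₀) ↔ nodeIdeal k • (⊤ : Submodule (nodeRing k) M₀) = ⊤ := by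
  rw [(node_T1Self_equivQuot k M₀).toEquiv.subsingleton_congr, Submodule.Quotient.subsingleton_iff]

/-- `𝔪 = (x̄_0, x̄_1)` is a proper ideal as soon as `k ≠ 0` (evaluation at the origin `B₀ → k` kills it).
[cite: Hartshorne2010, §3 Ex. 3.1, p. 25] -/
theorem nodeIdeal_ne_top [Nontrivial k] : nodeIdeal k ≠ ⊤ := by
  intro h
  let φ : nodeRing k →+* k := Ideal.Quotient.lift (Ideal.span {nodeEquation k}) (MvPolynomial.eval (0 : Fin 2 → k))
    (fun a ha => by
      obtain ⟨r, rfl⟩ := Ideal.mem_span_singleton'.mp ha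
      simp [nodeEquation])
  have hle : nodeIdeal k ≤ RingHom.ker φ := by
    rw [nodeIdeal, Ideal.span_le]
    rintro _ (rfl | rfl) <;> simp [φ]
  have h1 : φ 1 = 0 := hle (h ▸ Submodule.mem_top)
  exact one_ne_zero (by rwa [map_one] at h1)

/-- and **`T¹(B₀/k, B₀) ≅ B₀/𝔪 ≠ 0`** as soon as `k ≠ 0`: the node is NOT rigid. [cite: Hartshorne2010, §3 Ex. 3.1, p. 25] -/
theorem node_T1Self_nontrivial [Nontrivial k] : Nontrivial (T1Self k (nodeRing k) (nodeRing k)) := by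
  rw [← not_subsingleton_iff_nontrivial, node_T1_subsingleton_iff, smul_eq_mul, Ideal.mul_top]
  exact nodeIdeal_ne_top k

end Node

end Literature.AlgebraicGeometry.Deformation.LichtenbaumSchlessinger.Hypersurface

end
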